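import Mathlib
import HarnessLib
import Summits.HubbardSuperconductivity.HubbardSuperconductivity.Theorems.KLProgrammeKLRegimeSplitTwoLegSizesMSLowMixed

/-!
# Route `KLProgramme`, crux K3 — (E3a-MS) supplier: the SHAPES of the low-part totals `msLam` at Jackson degree `d = 4^{n₀}`
# (the `κ`'s of MS-A34-ter (K3); k3c3-p1 g4)

Seat hubbard-kl-k3c3-p1 (g4).  `…TwoLegSizesMSLowMixed` discharged the low-part totals of the (E3a-MS) chain as
`Λ_j := msLam R U d n₀ j = 3·2ʲ·16π⁸·(d+1)^{j−1}·Gfr₁U²·(4^{n₀})⁻¹/3`.  The fit arithmetic (`…TwoLegSizesMSFit*`, k3c3-p3) takes the totals in the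
shape `Λ₃ ≤ lam3·Gfr₁·U²·4^{n₀}`, `Λ₄ ≤ lam4·Gfr₁·U²·(4^{n₀})²`.  At the Jackson degree `d = 4^{n₀}` (forced by the order-zero transport entry) these
shapes hold with the ABSOLUTE constants `lam3 = 512π⁸`, `lam4 = 2048π⁸`:

* `msLam_nonneg` — `0 ≤ msLam R U d n₀ j`;
* **`msLam_three_le`** — `msLam R U (4^{n₀}) n₀ 3 ≤ 512π⁸·Gfr₁·U²·4^{n₀}` (from `(y+1)² ≤ 4y²`, `y = 4^{n₀} ≥ 1`);
* **`msLam_four_le`** — `msLam R U (4^{n₀}) n₀ 4 ≤ 2048π⁸·Gfr₁·U²·(4^{n₀})²` (from `(y+1)³ ≤ 8y³`).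

Proofs only; nothing about the model.
-/

noncomputable section

namespace Summit.HubbardSuperconductivity.HubbardSuperconductivity.Theorems.KLRegimeSplit

set_option linter.dupNamespace false -- summit = problem name (single-conjunct summit), D-0017

open Real Literature.MathematicalPhysics.QuantumLattice Literature.MathematicalPhysics.QuantumLattice.FermiRG

/-- The low-part totals are nonnegative. -/
theorem msLam_nonneg {R : RenConsts} (hR : ∀ j, 0 ≤ R.Gfr j) (U : ℝ) (d n₀ j : ℕ) : 0 ≤ msLam R U d n₀ j := by
  have h1 := hR 1
  unfold msLam
  positivity

/-- **Order-3 shape at `d = 4^{n₀}`:** `msLam R U (4^{n₀}) n₀ 3 ≤ 512π⁸·Gfr₁·U²·4^{n₀}`. -/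
theorem msLam_three_le {R : RenConsts} (hR : ∀ j, 0 ≤ R.Gfr j) (U : ℝ) (n₀ : ℕ) :
    msLam R U (4 ^ n₀) n₀ 3 ≤ 512 * π ^ 8 * R.Gfr 1 * U ^ 2 * (4 : ℝ) ^ n₀ := by
  have h1 := hR 1
  unfold msLam
  push_cast
  set y : ℝ := (4 : ℝ) ^ n₀ with hy
  have hy1 : 1 ≤ y := one_le_pow₀ (by norm_num)
  have hy0 : 0 < y := by positivity
  have key : (y + 1) ^ 2 * y⁻¹ ≤ 4 * y := by
    rw [← div_eq_mul_inv, div_le_iff₀ hy0]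
    nlinarith
  have hG : 0 ≤ 128 * π ^ 8 * R.Gfr 1 * U ^ 2 := by positivity
  calc 3 * (2 ^ 3 * (16 * π ^ 8 * (y + 1) ^ (3 - 1))) * (R.Gfr 1 * U ^ 2 * (y⁻¹ / 3))
        = 128 * π ^ 8 * R.Gfr 1 * U ^ 2 * ((y + 1) ^ 2 * y⁻¹) := by norm_num; ring
    _ ≤ 128 * π ^ 8 * R.Gfr 1 * U ^ 2 * (4 * y) := mul_le_mul_of_nonneg_left key hG
    _ = 512 * π ^ 8 * R.Gfr 1 * U ^ 2 * y := by ring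

/-- **Order-4 shape at `d = 4^{n₀}`:** `msLam R U (4^{n₀}) n₀ 4 ≤ 2048π⁸·Gfr₁·U²·(4^{n₀})²`. -/
theorem msLam_four_le {R : RenConsts} (hR : ∀ j, 0 ≤ R.Gfr j) (U : ℝ) (n₀ : ℕ) :
    msLam R U (4 ^ n₀) n₀ 4 ≤ 2048 * π ^ 8 * R.Gfr 1 * U ^ 2 * ((4 : ℝ) ^ n₀) ^ 2 := by
  have h1 := hR 1
  unfold msLam
  push_cast
  set y : ℝ := (4 : ℝ) ^ n₀ with hy
  have hy1 : 1 ≤ y := one_le_pow₀ (by norm_num)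
  have hy0 : 0 < y := by positivity
  have hpow : (y + 1) ^ 3 ≤ (2 * y) ^ 3 := pow_le_pow_left₀ (by positivity) (by linarith) 3
  have key : (y + 1) ^ 3 * y⁻¹ ≤ 8 * y ^ 2 :=
    calc (y + 1) ^ 3 * y⁻¹ ≤ (2 * y) ^ 3 * y⁻¹ := mul_le_mul_of_nonneg_right hpow (inv_nonneg.mpr hy0.le)
      _ = 8 * y ^ 2 := by field_simp; ring
  have hG : 0 ≤ 256 * π ^ 8 * R.Gfr 1 * U ^ 2 := by positivity
  calc 3 * (2 ^ 4 * (16 * π ^ 8 * (y + 1) ^ (4 - 1))) * (R.Gfr 1 * U ^ 2 * (y⁻¹ / 3))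
        = 256 * π ^ 8 * R.Gfr 1 * U ^ 2 * ((y + 1) ^ 3 * y⁻¹) := by norm_num; ring
    _ ≤ 256 * π ^ 8 * R.Gfr 1 * U ^ 2 * (8 * y ^ 2) := mul_le_mul_of_nonneg_left key hG
    _ = 2048 * π ^ 8 * R.Gfr 1 * U ^ 2 * y ^ 2 := by ring

end Summit.HubbardSuperconductivity.HubbardSuperconductivity.Theorems.KLRegimeSplit

end
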